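import Summits.ResolutionOfSingularities.ResolutionOfSingularities.Theorems.WeakOrderReduction
import Summits.ResolutionOfSingularities.ResolutionOfSingularities.Theorems.ForcedTowerClasses
import Literature.AlgebraicGeometry.Resolution.MarkedIdeals
import Literature.AlgebraicGeometry.Resolution.BlowupSequences
import Literature.AlgebraicGeometry.Resolution.BlowupSequencesExtensions
import Literature.AlgebraicGeometry.Resolution.PointBlowupShade
import Literature.AlgebraicGeometry.Resolution.PointBlowupShadeStrongMonomial
import Literature.AlgebraicGeometry.Resolution.PointBlowupMohBound
import Literature.AlgebraicGeometry.Resolution.HasseSchmidtDerivatives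
import Literature.AlgebraicGeometry.Resolution.ArithmeticalThreefoldsLocalPermissible
import HarnessLib

/-!
# TightDefectClasses — the polynomial pure-head slice of the forced-tower leaf, its forced-walk model and the
  tight-defect cut (decomp-res node «TightDefect», lens-3 g9), ROUTE-INDEPENDENT part

Source HOME/decomp-res-lens-3/g9/TightDefect.lean rev 3 (sha256 ce2c464e72c152cd, 1032 lines; rev 2 659820fe8e5282e8
CLEARED by decomp-res-crit-1, CRITIC-LEDGER row 61, 2026-08-30T08:54Z «SLICE + CERTIFIED-TRANSLATION NODE WITH ONE
PROVED LEAF, with a critic COLLAPSE re-tagging the e = 1 column»; rev 3 books the collapse, CRITIC-NOTE 09:02:33Z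
«tags
unchanged» + ONE typing correction applied HERE: the valuative port `ShallowColumnPort` is typed from the
NORMALLY-FLAT
tree fact `CossartPiltant2019LocalPermissible` (centres with `m(y) = m(pt i)`), not from its `…Sing` sibling).
This file carries the route-independent vocabulary verbatim (imports: Literature + the landed route-independent
`Theorems.WeakOrderReduction` / `Theorems.ForcedTowerClasses` only); the by-name wiring to the MaxContactCut items
(30253 `NoForcedTowers`, 30256, `E 1`, 29273 `RungOne`) is `Theorems.MaxContactCutTightDefect`, and the kernel-checked
DECIDED piece `strongWalksTerminate : StrongWalksTerminate` is `Theorems.TightDefectStrongWalks`.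

THE SLICE (E-format).  `PolyPureTowersTerminate`: no infinite forced point tower (tree `ForcedTower`) is ROOTED at a
POLYNOMIAL PURE-HEAD datum `(Spec k[u₁,u₂,u₃][Z], (Z^q + F), ∅, q)`, `q = pᵉ`, `k` perfect (Moh 1987, Hauser 2010 §F;
Benito–Villamayor 2012 Rem. 3.9: the reduction TO this case is expected but unproved — a SLICE, not a partition).
EXACT exponent columns `… ⟺ …Shallow (e = 1) ∧ …Deep (e ≥ 2)`; the `e = 1` column is KNOWN-MOD-PORT («forced ⇒ local ⇒
Cossart–Piltant 2019 Thm. 1.5 (i)», tree fact BY NAME through `ShallowColumnPort`; prover target #20); the `e ≥ 2`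
column is THE HONEST RESIDUAL («multiplicity bigger than the characteristic», Cossart–Piltant 2019 p.4).
THE TRANSLATION (ports `TowerDictionary` / `TowerRealisation`, COSTUME(cite), M-sized): such a tower IS an infinite
FORCED WALK (`ForcedWalk`: chart, point on the new exceptional component, `IsEquimultiplePoint`, tree
`PointBlowup.step`,
and `IsolatedTop` = forcedness typed IN the model over the tree's `hasseDeriv`) of the typed point-blow-up model
`PointBlowup.State (Fin 3) K` over a perfect `K ⊇ k`, from a ROOT state (`IsRoot`).
THE SPLIT BENEATH (EXACT, `walksTerminate_iff`): `WalksTerminate ⟺ StrongWalksTerminate ∧ DefectWalksTerminate` —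
no stage of SHADE 0 (Benito–Villamayor's strong monomial case; PROVED in `TightDefectStrongWalks`) / positive TIGHT
DEFECT at every stage (B–V's named open problem «monomial ⇒ strong monomial in arbitrary dimension» =
Kawanoue–Matsuki's
«τ = 1 monomial ⇒ tight monomial», a SUFFICIENT printed programme, not an equivalent); deep residual
`DefectWalksTerminateDeep` (e ≥ 2); satellite-recurrent part `SatDefectWalksTerminate`.

Tags (critic row 61): `StrongWalksTerminate` PROVED; `TowerDictionary` / `TowerRealisation` / `ShallowColumnPort`
COSTUME(M) 0; `PolyPureTowersTerminate` SLICE — `…Shallow` KNOWN-MOD-PORT(CP2019 1.5 (i)), `…Deep` UNDECIDED · located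
residual; `WalksTerminate` / `DefectWalksTerminate(Deep)` likewise; `SatDefectWalksTerminate` 0; `PolyPureReduction`
UNDECIDED rung.  No `sorry`, no instances, no notation, no `set_option`.

References: A. Benito, O. Villamayor, Compositio Math. 149 (2013) (arXiv:1004.1803v2 p.3, Def. 7.10, Prop. 7.18,
Thm. 7.19); Math. Ann. 353 (2012) (arXiv:1103.3464 Thm. 2.11, Rem. 3.9, §4); H. Kawanoue, K. Matsuki, Rev. Mat.
Iberoam. 34 (2018) (arXiv:1507.05195 p.5, p.9); Hauser2010 §§F–G; Moh1987; CossartPiltant2019 Thm. 1.5 (i), Def. 2.20,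
p.4; Hartshorne1977 II Ex. 4.12, II.7.16; BierstoneGrigorievMilmanWlodarczyk2011 §3.1–3.2.
-/

open CategoryTheory AlgebraicGeometry
open Literature.AlgebraicGeometry.Resolution
open Summit.ResolutionOfSingularities.ResolutionOfSingularities.Theorems.WeakOrderReduction
open Summit.ResolutionOfSingularities.ResolutionOfSingularities.Theorems.ForcedTowerClasses

namespace Summit.ResolutionOfSingularities.ResolutionOfSingularities.Theorems.TightDefectClasses

/-! ## §1 The polynomial pure-head slice (E-format, tree currency) -/

/-- The regular affine base ring `k[u₁,u₂,u₃]`.  DEFINITION (support). -/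
noncomputable abbrev Base (k : Type) [Field k] : Type := MvPolynomial (Fin 3) k

/-- The ambient `𝔸⁴ = Spec k[u₁,u₂,u₃][Z]`.  DEFINITION (support). -/
noncomputable abbrev PureAmbient (k : Type) [Field k] : Scheme.{0} :=
  Spec (CommRingCat.of (Polynomial (Base k)))

/-- The ideal sheaf `(Z^q + F)` on `𝔸⁴`.  DEFINITION (support). (Sources: Hauser2010 §F.) -/
noncomputable def pureIdeal (k : Type) [Field k] (q : ℕ) (F : Base k) : (PureAmbient k).IdealSheafData :=
  Scheme.IdealSheafData.ofIdealTop
    (Ideal.span {(Scheme.ΓSpecIso (CommRingCat.of (Polynomial (Base k)))).inv.hom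
      (Polynomial.X ^ q + Polynomial.C F)})

/-- The POLYNOMIAL PURE-HEAD marked ideal `(𝔸⁴, (Z^q + F), ∅, q)`.  DEFINITION (support). -/
noncomputable def pureMarked (k : Type) [Field k] (q : ℕ) (F : Base k) : MarkedIdeal (PureAmbient k) :=
  ⟨pureIdeal k q F, [], q⟩

/-- The datum REACHED along a prefix `s` (boundary forgotten — the weak format ignores it).  DEFINITION (support). -/
noncomputable def reachMarked (k : Type) [Field k] (q : ℕ) (F : Base k) (s : CentreSeq (PureAmbient k)) :
    MarkedIdeal s.top :=
  ⟨(s.transformMarked (pureMarked k q F)).ideal, [], q⟩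

/-- The `SeqDimFour` frame (verbatim binders) for `(X, I)` at order `q` over `k`.  DEFINITION (support). -/
def InFrame (q : ℕ) (k : Type) [Field k] (X : Scheme.{0}) (I : X.IdealSheafData) : Prop :=
  ∃ g : X ⟶ Spec (.of k), IsSeparated g ∧ LocallyOfFiniteType g ∧ QuasiCompact g ∧
    Scheme.IsRegular X ∧ topologicalKrullDim X ≤ 4 ∧ ∀ y : X, idealOrder I y ≤ ((q : ℕ) : ℕ∞)

/-- A forced tower `T` is ROOTED at the polynomial pure head `(k, q, F)`: its stage 0 is (isomorphic to) `𝔸⁴_k` with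
`D 0` the pulled-back pure-head datum.  DEFINITION (support). -/
def Rooted (T : ForcedTower) (k : Type) [Field k] (q : ℕ) (F : Base k) : Prop :=
  ∃ ι : PureAmbient k ≅ T.St 0, (T.D 0).comap ι.hom = pureMarked k q F

/-- **Rung `PolyPureReduction`** — every datum weakly-admissibly reachable from a polynomial pure head `(Z^q + F, q)`,
`q = pᵉ`, `k` perfect, in the `SeqDimFour` frame, has a WEAK RESOLUTION at marking `q`.  [rung · NECESSARY from `E 1`
(`MaxContactCutTightDefect.polyPureReduction_of_e_one`) · WEAKER by letter · UNDECIDED]  (Sources: Hauser2010 §F;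
CossartPiltant2019 Thm 1.5; Benito–Villamayor 2012 Rem. 3.9.) -/
def PolyPureReduction : Prop :=
  ∀ p : ℕ, p.Prime → ∀ e : ℕ, 1 ≤ e → ∀ (k : Type) [Field k] [CharP k p] [PerfectField k] (F : Base k)
    (s : CentreSeq (PureAmbient k)), WeakAdmissible s (pureMarked k (p ^ e) F) →
    InFrame (p ^ e) k s.top (reachMarked k (p ^ e) F s).ideal →
    ∃ t : CentreSeq s.top, WeakResolution t (reachMarked k (p ^ e) F s)

/-- **Slice `PolyPureTowersTerminate`** — NO infinite forced point tower (tree `ForcedTower`) is rooted at a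
polynomial
pure-head datum `(𝔸⁴_k, (Z^q + F), ∅, q)`, `q = pᵉ`, `k` perfect.  [slice of 30253 · NECESSARY by instantiation
(`MaxContactCutTightDefect.polyPureTowersTerminate_of_noForcedTowers`) · WEAKER by letter · UNDECIDED · translated by
`TowerDictionary` into `WalksTerminate`]  (Sources: BierstoneGrigorievMilmanWlodarczyk2011 §3.1–3.2; Hauser2010
§§F–G.) -/
def PolyPureTowersTerminate : Prop :=
  ∀ p : ℕ, p.Prime → ∀ e : ℕ, 1 ≤ e → ∀ (k : Type) [Field k] [CharP k p] [PerfectField k] (F : Base k)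
    (T : ForcedTower) (g : T.St 0 ⟶ Spec (.of k)), IsBase (T.St 0) g → IsDatum (p ^ e) (T.D 0) →
    (T.D 0).boundary = [] → Rooted T k (p ^ e) F → False

/-- **Column `PolyPureTowersTerminateShallow`** (`e = 1`, heads `Z^p + F`).  [KNOWN-MOD-PORT(M): «forced ⇒ local ⇒
Cossart–Piltant 2019 Thm. 1.5 (i)» = tree fact `CossartPiltant2019LocalPermissible` BY NAME through the valuative port
`ShallowColumnPort` (critic row 61; prover target #20) · NECESSARY (`shallow_of_polyPureTowers`) · WEAKER by letter]
(Sources: CossartPiltant2019 Thm. 1.5 (i), Def. 2.20.) -/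
def PolyPureTowersTerminateShallow : Prop :=
  ∀ p : ℕ, p.Prime → ∀ (k : Type) [Field k] [CharP k p] [PerfectField k] (F : Base k)
    (T : ForcedTower) (g : T.St 0 ⟶ Spec (.of k)), IsBase (T.St 0) g → IsDatum (p ^ 1) (T.D 0) →
    (T.D 0).boundary = [] → Rooted T k (p ^ 1) F → False

/-- **Column `PolyPureTowersTerminateDeep`** (`e ≥ 2`, heads `Z^{pᵉ} + F`, multiplicity `pᵉ > p`).  [THE HONEST E-SIDE
RESIDUAL after the critic's collapse · UNDECIDED · LOCATED · IDEA-NEEDED · NECESSARY (`deep_of_polyPureTowers`) ·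
⟸ `TowerDictionary ∧ DefectWalksTerminateDeep` (`TightDefectStrongWalks.polyPureTowersTerminateDeep_of_defectDeep`)]
(Sources: CossartPiltant2019 p.4 «multiplicity bigger than the residue characteristic»; Hauser2010 §§F–G.) -/
def PolyPureTowersTerminateDeep : Prop :=
  ∀ p : ℕ, p.Prime → ∀ e : ℕ, 2 ≤ e → ∀ (k : Type) [Field k] [CharP k p] [PerfectField k] (F : Base k)
    (T : ForcedTower) (g : T.St 0 ⟶ Spec (.of k)), IsBase (T.St 0) g → IsDatum (p ^ e) (T.D 0) →
    (T.D 0).boundary = [] → Rooted T k (p ^ e) F → False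

/-- **PORT `ShallowColumnPort`** («forced ⇒ local ⇒ CP»: Chevalley — the union of the local rings of the strict
transforms at the tower points is dominated by a valuation ring (Hartshorne II Ex. 4.12); a local Hironaka-permissible
centre through `pt i` is NORMALLY FLAT, so `m(y) = m(pt i) = p` (Bennett / CJS) and `y ∈ Sing_p =` the top locus,
which
near `pt i` is `{pt i}` (`ForcedTower.isolated`) — every local permissible blow-up along `μ` is the point blow-up,
CP's
local sequence IS the tower and its regular final stage contradicts multiplicity `p ≥ 2`).  Typed from the
NORMALLY-FLAT
tree fact (critic's correction of rev 3, CRITIC-NOTE 09:02:33Z).  [KNOWN-MOD-PORT(M) · COSTUME(cite) · counted 0 ·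
hypothesis of `shallow_of_port` only · prover target #20]  (Sources: CossartPiltant2019 Thm. 1.5 (i), §2.2;
Hartshorne1977 II Ex. 4.12.) -/
def ShallowColumnPort : Prop :=
  Literature.AlgebraicGeometry.Resolution.CossartPiltant2019LocalPermissible.{0} → PolyPureTowersTerminateShallow

/-! ## §2 Forced walks of the typed point-blow-up model (new typed objects over `PointBlowup.State`) -/

section Model

open MvPolynomial
open Literature.AlgebraicGeometry.Resolution.Hauser2010
open Literature.AlgebraicGeometry.Resolution.PointBlowup

variable {σ : Type} [DecidableEq σ] {K : Type} [Field K] [DecidableEq K]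

/-- The TOP-LOCUS IDEAL `J_F = (∂^{(d)}F : 0 < |d| < q)` over the tree's `hasseDeriv`: its zero set is the projection
to the `u`-space of the multiplicity-`q` locus of `Z^q + F(u)` (order criterion with Hasse–Schmidt derivations; the
`Z`-derivatives of `Z^{pᵉ}` of order `< pᵉ` vanish).  DEFINITION (support).  (Sources: Villamayor 2008 §2.6, §4.1;
Benito–Villamayor 2013 §1.13–1.17.) -/
noncomputable def topIdeal (q : ℕ) (F : MvPolynomial σ K) : Ideal (MvPolynomial σ K) :=
  Ideal.span ((fun d => hasseDeriv K d F) '' {d : σ →₀ ℕ | d ≠ 0 ∧ d.degree < q})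

/-- `IsolatedTop q F`: the origin is an ISOLATED point of the top locus `V(J_F)` — some `g` with `g(0) ≠ 0`
multiplies a
power of every variable into `J_F` (for `F = 0` this fails, as it should).  FORCEDNESS inside the model: the point
blow-up
is the only weakly admissible move.  DEFINITION (new typed object).  (Sources: BierstoneGrigorievMilmanWlodarczyk2011
Def. 3.1.3.) -/
def IsolatedTop (q : ℕ) (F : MvPolynomial σ K) : Prop :=
  ∃ (N : ℕ) (g : MvPolynomial σ K), MvPolynomial.constantCoeff g ≠ 0 ∧
    ∀ i : σ, g * MvPolynomial.X i ^ N ∈ topIdeal q F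

/-- A ROOT state: boundary-free (`r = 0`), cleaned (no `q`-th power monomials), of order `≥ q` at the origin.
DEFINITION (support).  (Sources: Hauser2010 §F.) -/
def IsRoot (q : ℕ) (s : State σ K) : Prop :=
  s.r = 0 ∧ deletePthPowers q s.F = s.F ∧ ((q : ℕ) : ℕ∞) ≤ ordZero s.F

/-- An infinite FORCED WALK of the model from `s₀`: charts `j i`, points `b i` ON the new exceptional component,
EQUIMULTIPLE, states `st (i+1) = step q (j i) (b i) (st i)` (tree `PointBlowup.step`), and the origin an ISOLATED top
point at every stage, so that each point blow-up is forced.  DEFINITION (the node's new typed object).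
(Sources: Hauser2010 §§F–G.) -/
structure ForcedWalk (q : ℕ) (s₀ : State σ K) where
  /-- the chart `u_{j i}` of the `i`-th point blow-up -/
  j : ℕ → σ
  /-- the point of the `i`-th exceptional divisor blown up next -/
  b : ℕ → σ → K
  /-- the states -/
  st : ℕ → State σ K
  /-- the walk starts at `s₀` -/
  st_zero : st 0 = s₀
  /-- each state is the tree's `step` of the previous one -/
  st_succ : ∀ i, st (i + 1) = step q (j i) (b i) (st i)
  /-- the point lies ON the new exceptional component -/
  onExc : ∀ i, b i (j i) = 0
  /-- the point is EQUIMULTIPLE (order `≥ q` again) -/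
  equimult : ∀ i, IsEquimultiplePoint q (j i) (b i) (st i)
  /-- the origin is an isolated top point at every stage -/
  isolated : ∀ i, IsolatedTop q (st i).F

/-- The `i`-th point is a SATELLITE point: it lies on an old component `u_{i'} = 0`, `i' ≠ j i`, of positive
multiplicity.  DEFINITION (support).  (Sources: Hauser2010 §G.) -/
def ForcedWalk.Satellite {q : ℕ} {s₀ : State σ K} (W : ForcedWalk q s₀) (i : ℕ) : Prop :=
  ∃ i' : σ, i' ≠ W.j i ∧ W.b i i' = 0 ∧ 0 < (W.st i).r i'

end Model

/-! ## §3 The model pieces (|σ| = 3, all perfect `K` of characteristic `p`, all `q = pᵉ`) -/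

open Literature.AlgebraicGeometry.Resolution.PointBlowup in
/-- **`WalksTerminate`** — the model has NO infinite forced walk from a root state (three base variables).  [image
of the
slice under the dictionary · NECESSARY mod `TowerRealisation` · WEAKER · UNDECIDED · EXACT cut `walksTerminate_iff`]
(Sources: Hauser2010 §§F–G.) -/
def WalksTerminate : Prop :=
  ∀ p : ℕ, p.Prime → ∀ e : ℕ, 1 ≤ e → ∀ (K : Type) [Field K] [CharP K p] [PerfectField K] [DecidableEq K]
    (s₀ : State (Fin 3) K), IsRoot (p ^ e) s₀ → ForcedWalk (p ^ e) s₀ → False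

open Literature.AlgebraicGeometry.Resolution.PointBlowup in
/-- **`StrongWalksTerminate`** — an infinite forced walk has NO stage of SHADE 0 (= Benito–Villamayor's STRONG
MONOMIAL
CASE at the point, tree `PointBlowup.State.shade_eq_zero_iff_of_dvd`).  [DECIDED — PROVED:
`TightDefectStrongWalks.strongWalksTerminate` · WEAKER (`strong_of_walks`)]  (Sources: Benito–Villamayor 2013
Thm. 7.19, Prop. 7.18, Def. 7.10; Hauser2010 §F.) -/
def StrongWalksTerminate : Prop :=
  ∀ p : ℕ, p.Prime → ∀ e : ℕ, 1 ≤ e → ∀ (K : Type) [Field K] [CharP K p] [PerfectField K] [DecidableEq K]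
    (s₀ : State (Fin 3) K), IsRoot (p ^ e) s₀ → ∀ W : ForcedWalk (p ^ e) s₀, (∃ i, (W.st i).shade = 0) → False

open Literature.AlgebraicGeometry.Resolution.PointBlowup in
/-- **`DefectWalksTerminate`** (whole-`e` form of the located residual): no infinite forced walk keeps POSITIVE TIGHT
DEFECT (shade `≥ 1`, B–V «monomial but not strong monomial») at EVERY stage.  [UNDECIDED · IDEA-NEEDED · WEAKER
(`defect_of_walks`) · ⟺ `WalksTerminate`
(`TightDefectStrongWalks.walksTerminate_iff_defect`) · the B–V / K–M tight-defect
programme is a SUFFICIENT printed route, not an equivalent · BARRIER-touching: the defect is not monotone (Moh jumps)]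
(Sources: Benito–Villamayor 2013 §7; Kawanoue–Matsuki 2018 §1; Hauser2010 §G; Moh1987.) -/
def DefectWalksTerminate : Prop :=
  ∀ p : ℕ, p.Prime → ∀ e : ℕ, 1 ≤ e → ∀ (K : Type) [Field K] [CharP K p] [PerfectField K] [DecidableEq K]
    (s₀ : State (Fin 3) K), IsRoot (p ^ e) s₀ → ∀ W : ForcedWalk (p ^ e) s₀, (∀ i, 1 ≤ (W.st i).shade) → False

open Literature.AlgebraicGeometry.Resolution.PointBlowup in
/-- **`SatDefectWalksTerminate`** — the SATELLITE-RECURRENT part of the residual: no infinite forced walk with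
positive
defect throughout visits satellite points infinitely often.  [UNDECIDED · IDEA-NEEDED · WEAKER
(`satDefect_of_defect`) ·
⟺ 30256 ∩ (polynomial pure heads) modulo `TowerDictionary`, residual score 0]  (Sources: Hauser2010 §G; Moh1987.) -/
def SatDefectWalksTerminate : Prop :=
  ∀ p : ℕ, p.Prime → ∀ e : ℕ, 1 ≤ e → ∀ (K : Type) [Field K] [CharP K p] [PerfectField K] [DecidableEq K]
    (s₀ : State (Fin 3) K), IsRoot (p ^ e) s₀ → ∀ W : ForcedWalk (p ^ e) s₀, (∀ i, 1 ≤ (W.st i).shade) →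
    (∀ N : ℕ, ∃ i, N ≤ i ∧ W.Satellite i) → False

open Literature.AlgebraicGeometry.Resolution.PointBlowup in
/-- **`DefectWalksTerminateDeep` — THE RE-LOCATED RESIDUAL after critic row 61's collapse**: no infinite forced
walk at
exponent `q = pᵉ`, `e ≥ 2`, keeps positive tight defect at every stage.  [UNDECIDED · IDEA-NEEDED · WEAKER
(`defectDeep_of_defect`) · INSTRUMENTABLE T-tight-1 at `q = p²` (the printed kangaroo / Moh specimens are all
`e = 1`)]
(Sources: CossartPiltant2019 p.4; Benito–Villamayor 2013 §7; Kawanoue–Matsuki 2018 §1; Moh1987.) -/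
def DefectWalksTerminateDeep : Prop :=
  ∀ p : ℕ, p.Prime → ∀ e : ℕ, 2 ≤ e → ∀ (K : Type) [Field K] [CharP K p] [PerfectField K] [DecidableEq K]
    (s₀ : State (Fin 3) K), IsRoot (p ^ e) s₀ → ∀ W : ForcedWalk (p ^ e) s₀, (∀ i, 1 ≤ (W.st i).shade) → False

/-! ## §4 The translation (the lens's ONE EQUIV; ports, COSTUME(cite), KNOWN-MOD-PORT(M), counted 0) -/

open Literature.AlgebraicGeometry.Resolution.PointBlowup in
/-- **PORT `TowerDictionary`**: an infinite forced tower rooted at `(k, pᵉ, F)`, `k` perfect, cannot exist if the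
model
has no infinite forced walk from a root state over any perfect field of characteristic `p` — such a tower IS such a
walk
over the compositum `K` of the residue fields of its points (affine charts, controlled transform of `((Z^q+F), q)` =
`(Z'^q + chartTransform)`, cleaning = `Z`-re-centring over perfect `K`, order `≥ q` = `IsEquimultiplePoint`,
isolation =
`IsolatedTop` by Zariski–Nagata–Hasse; POLYNOMIAL input ⇒ no completion).  [KNOWN-MOD-PORT(M) · COSTUME(cite) ·
hypothesis of `polyPureTowersTerminate_of_model` only]  (Sources: Hauser2010 §F;
BierstoneGrigorievMilmanWlodarczyk2011
§3.1–3.2; Benito–Villamayor 2013 §1.13–1.17.) -/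
def TowerDictionary : Prop :=
  ∀ p : ℕ, p.Prime → ∀ e : ℕ, 1 ≤ e → ∀ (k : Type) [Field k] [CharP k p] [PerfectField k] (F : Base k)
    (T : ForcedTower) (g : T.St 0 ⟶ Spec (.of k)), IsBase (T.St 0) g → IsDatum (p ^ e) (T.D 0) →
    (T.D 0).boundary = [] → Rooted T k (p ^ e) F →
    (∀ (K : Type) [Field K] [CharP K p] [PerfectField K] [DecidableEq K] (s₀ : State (Fin 3) K),
      IsRoot (p ^ e) s₀ → ForcedWalk (p ^ e) s₀ → False) → False

/-- **PORT `TowerRealisation`** (converse direction, EXACTNESS of the translation): an infinite forced model walk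
from a
root state over a perfect `K` IS an infinite forced tower rooted at `(K, pᵉ, s₀.F)` (Hartshorne II.7.16).
[KNOWN-MOD-PORT(M) · COSTUME(cite) · hypothesis of `walksTerminate_of_polyPureTowers` only]  (Sources: Hauser2010 §F;
Hartshorne1977 II.7.16.) -/
def TowerRealisation : Prop :=
  PolyPureTowersTerminate → WalksTerminate

/-! ## §5 Kernels (PROVED, pure logic; the E-side wiring BY NAME is in `Theorems.MaxContactCutTightDefect`) -/

section Kernels

open Literature.AlgebraicGeometry.Resolution.PointBlowup

/-- **Slice ⟸ model** through the dictionary port (modus tollens). [folklore] -/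
theorem polyPureTowersTerminate_of_model (hD : TowerDictionary) (hW : WalksTerminate) : PolyPureTowersTerminate := by
  intro p hp e he k _ _ _ F T g hB hDat hE hR
  exact hD p hp e he k F T g hB hDat hE hR (fun K _ _ _ _ s₀ hs W => hW p hp e he K s₀ hs W)

/-- **Model ⟸ slice** through the realisation port. [folklore] -/
theorem walksTerminate_of_polyPureTowers (hR : TowerRealisation) (h : PolyPureTowersTerminate) :
    WalksTerminate :=
  hR h

/-- **EXACT modulo ports: slice ⟺ model.** [folklore] -/
theorem polyPureTowersTerminate_iff_walksTerminate (hD : TowerDictionary) (hR : TowerRealisation) :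
    PolyPureTowersTerminate ↔ WalksTerminate :=
  ⟨walksTerminate_of_polyPureTowers hR, polyPureTowersTerminate_of_model hD⟩

/-- `StrongWalksTerminate ⟸ WalksTerminate` (an extra hypothesis on the walk). [folklore] -/
theorem strong_of_walks (h : WalksTerminate) : StrongWalksTerminate :=
  fun p hp e he K _ _ _ _ s₀ hs W _ => h p hp e he K s₀ hs W

/-- `DefectWalksTerminate ⟸ WalksTerminate`. [folklore] -/
theorem defect_of_walks (h : WalksTerminate) : DefectWalksTerminate :=
  fun p hp e he K _ _ _ _ s₀ hs W _ => h p hp e he K s₀ hs W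

/-- `SatDefectWalksTerminate ⟸ DefectWalksTerminate`. [folklore] -/
theorem satDefect_of_defect (h : DefectWalksTerminate) : SatDefectWalksTerminate :=
  fun p hp e he K _ _ _ _ s₀ hs W hsh _ => h p hp e he K s₀ hs W hsh

/-- **`StrongWalksTerminate ∧ DefectWalksTerminate ⟹ WalksTerminate`** — a walk either has a stage of shade 0 or keeps
shade `≥ 1` throughout (`ℕ∞`: `shade ≠ 0 ⟺ 1 ≤ shade`). [folklore] -/
theorem walks_of_pieces (hS : StrongWalksTerminate) (hΔ : DefectWalksTerminate) : WalksTerminate := by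
  intro p hp e he K _ _ _ _ s₀ hs W
  by_cases h0 : ∃ i, (W.st i).shade = 0
  · exact hS p hp e he K s₀ hs W h0
  · exact hΔ p hp e he K s₀ hs W (fun i => Order.one_le_iff_ne_zero.mpr (fun h => h0 ⟨i, h⟩))

/-- **EXACT: `WalksTerminate ⟺ StrongWalksTerminate ∧ DefectWalksTerminate`.** [folklore] -/
theorem walksTerminate_iff : WalksTerminate ↔ StrongWalksTerminate ∧ DefectWalksTerminate :=
  ⟨fun h => ⟨strong_of_walks h, defect_of_walks h⟩, fun h => walks_of_pieces h.1 h.2⟩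

/-- **Slice from the pieces**: dictionary + zero-defect piece + the residual. [folklore] -/
theorem polyPureTowersTerminate_of_pieces (hD : TowerDictionary) (hS : StrongWalksTerminate)
    (hΔ : DefectWalksTerminate) : PolyPureTowersTerminate :=
  polyPureTowersTerminate_of_model hD (walks_of_pieces hS hΔ)

/-- **NECESSITY LEDGER** (modulo the realisation port): slice ⟹ every model piece. [folklore] -/
theorem pieces_of_polyPureTowers (hR : TowerRealisation) (hP : PolyPureTowersTerminate) :
    WalksTerminate ∧ StrongWalksTerminate ∧ DefectWalksTerminate ∧ SatDefectWalksTerminate :=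
  have hW := walksTerminate_of_polyPureTowers hR hP
  ⟨hW, strong_of_walks hW, defect_of_walks hW, satDefect_of_defect (defect_of_walks hW)⟩

/-- The `e = 1` column ⟸ the slice (NECESSARY). [folklore] -/
theorem shallow_of_polyPureTowers (h : PolyPureTowersTerminate) : PolyPureTowersTerminateShallow :=
  fun p hp k _ _ _ F T g hg hD hB hR => h p hp 1 le_rfl k F T g hg hD hB hR

/-- The `e ≥ 2` column ⟸ the slice (NECESSARY). [folklore] -/
theorem deep_of_polyPureTowers (h : PolyPureTowersTerminate) : PolyPureTowersTerminateDeep :=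
  fun p hp e he k _ _ _ F T g hg hD hB hR => h p hp e (one_le_two.trans he) k F T g hg hD hB hR

/-- The two columns give back the slice. [folklore] -/
theorem polyPureTowersTerminate_of_columns (h₁ : PolyPureTowersTerminateShallow) (h₂ : PolyPureTowersTerminateDeep) :
    PolyPureTowersTerminate := by
  intro p hp e he k _ _ _ F T g hg hD hB hR
  rcases Nat.lt_or_ge e 2 with hlt | hge
  · obtain rfl : e = 1 := le_antisymm (Nat.lt_succ_iff.mp hlt) he
    exact h₁ p hp k F T g hg hD hB hR
  · exact h₂ p hp e hge k F T g hg hD hB hR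

/-- **EXACT: slice ⟺ shallow column ∧ deep column.** [folklore] -/
theorem polyPureTowersTerminate_iff_columns :
    PolyPureTowersTerminate ↔ PolyPureTowersTerminateShallow ∧ PolyPureTowersTerminateDeep :=
  ⟨fun h => ⟨shallow_of_polyPureTowers h, deep_of_polyPureTowers h⟩,
    fun h => polyPureTowersTerminate_of_columns h.1 h.2⟩

/-- The shallow column from Cossart–Piltant 2019 Thm. 1.5 (i) (NORMALLY-FLAT tree fact, BY NAME) through the
valuative port. [folklore] -/
theorem shallow_of_port (hCP : Literature.AlgebraicGeometry.Resolution.CossartPiltant2019LocalPermissible.{0})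
    (hV : ShallowColumnPort) : PolyPureTowersTerminateShallow :=
  hV hCP

/-- The deep model residual ⟸ the whole-`e` residual (NECESSARY). [folklore] -/
theorem defectDeep_of_defect (h : DefectWalksTerminate) : DefectWalksTerminateDeep :=
  fun p hp e he K _ _ _ _ s₀ hs W hsh => h p hp e (one_le_two.trans he) K s₀ hs W hsh

end Kernels


end Summit.ResolutionOfSingularities.ResolutionOfSingularities.Theorems.TightDefectClasses
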